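import Mathlib.Data.ZMod.Basic
import Mathlib.Algebra.QuadraticAlgebra.Basic
import Mathlib.Tactic.Ring
import Mathlib.Tactic.Linarith
import HarnessLib

/-!
# Venture HSemireg — the parity skeleton of THEOREM 53 (isosceles second-kind pair blocks are never reached when `a, s` are odd):
# `d ≡ 6 (mod 8)`, the four odd witnesses, and «`t` or `N′` is odd unless `m ≡ 1 (mod 8)`» (ENGINE-W PROBE5 §53, COROLLARIES 53.7 ∕ 53.8)

HONEST FRAMING. Lean index of the computation cell `pub-hsemireg`, widening group ENGINE-W (code A, seat `engine-w-1`, gen 16).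
INTEGER ∕ `ℤ[ω]` ARITHMETIC ONLY; the lattices, the antilinear structures `ψ`, `gψ`, the isometry argument of THEOREM 53 and
LEMMA 53.9's norm formula enter BY VALUE (docstring). No abelian variety, sheaf, `Ext` group or semiregularity map is constructed;
nothing here says that HC, HC_CM or HC_AV holds. Theorems only (0 `def`, 0 named fact, 0 `sorry`).

SOURCE (the cell's own results): `widen/ENGINE-W/out/probe5/PROBE5-STIZ-A.md` §53 (v5.0–v5.4, this seat; file `668cfb4998ba8039`):
THEOREM 53 — for `H = [[a, s√−3],[−s√−3, a]]` with `a, s` odd the split seed never reaches `Λ_X(H; A, N)` at `m = −2`; the proof needs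
ODD vectors in `Fix ψ` and `Fix(gψ)`. LEMMA 53.9: on `Λ_X = O_K² + μH̄⁻¹O_K²` (`tN = A² − m`, `N = N′d`) the rational part of the norm is
`𝒫(u + μH̄⁻¹y) = t·H[u] + A·Tr(uᵀȳ) + N′·H[ȳ]`, and the witnesses are `u = (0,1)` (`𝒫 = t·a`), `u = (ω, ω̄)` (`𝒫 = t·(2a + 3s)`),
`y = (0,1)` (`𝒫 = N′·a`), `y = (ω, ω̄)` (`𝒫 = N′·(2a − 3s)`) — with `H[(0,1)] = a`, `H[(ω, ω̄)] = 2a + 3s`, `H[(ω̄, ω)] = 2a − 3s`.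
COROLLARY 53.7 ∕ 53.8: `d = a² − 3s² ≡ 2 (mod 4)` forces `N` even; `t` and `N′` both even would force `8 ∣ A² − m`, i.e. `m ≡ 1 (mod 8)`;
so for `m ≢ 1 (mod 8)` one of `t, N′` is odd and a witness is odd. What the kernel holds:

* §1 `isosceles_det_mod_eight` — `a, s` odd ⟹ `a² − 3s² ≡ 6 (mod 8)` (so `d ≡ 2 (mod 4)`, `d = 2·odd`).
* §2 the witness values in `ℤ[ω] = QuadraticAlgebra ℤ (−1) (−1)` coordinates: `hermValue_e2` (`H[(0,1)] = a`), `hermValue_omega_pair`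
  (`H[(ω, ω̄)] = 2a + 3s`), `hermValue_omegaBar_pair` (`H[(ω̄, ω)] = 2a − 3s`) — as explicit evaluations of
  `H[z] = a(|z₁|² + |z₂|²) + Tr(z₁·s√−3·z̄₂)` with `|x + yω|² = x² − xy + y²`, `√−3 = 1 + 2ω`, `Tr(p + qω) = 2p − q`;
  and their parities `odd_witness_t` ∕ `odd_witness_N` (`a, s` odd: `t·a`, `t(2a+3s)` odd iff `t` odd; `N′a`, `N′(2a−3s)` odd iff `N′` odd).
* §3 **`odd_t_or_odd_N'`** — `t·N′·d = A² − m`, `d ≡ 6 (mod 8)`, `m % 8 ≠ 1` (as an integer residue; `m` squarefree negative has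
  `m % 8 ∈ {1,2,3,5,6,7}`) ⟹ `t` odd ∨ `N′` odd (COROLLARY 53.8's arithmetic; `decide` over `ZMod 8` after reduction).
WHAT IS NOT HERE: LEMMA 53.9 itself, the lattice∕isometry argument (THEOREM 53), LEMMA 53.4 (`h(ℚ(ζ₁₂)) = 1`), CONJECTURE 53.6's residual class.
-/

namespace Summit.Ventures.HSemireg.IsoscelesParity

open QuadraticAlgebra

/-! ## §1 The discriminant of an isosceles second-kind form with odd entries -/

/-- `a, s` odd ⟹ `a² − 3s² ≡ 6 (mod 8)` — in particular `d ≡ 2 (mod 4)`: the discriminant is twice an odd number. [kernel] -/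
theorem isosceles_det_mod_eight (a s : ℤ) (ha : Odd a) (hs : Odd s) : (a ^ 2 - 3 * s ^ 2) % 8 = 6 := by
  obtain ⟨k, rfl⟩ := ha
  obtain ⟨l, rfl⟩ := hs
  have key : ∀ x y : ZMod 8, (2 * x + 1) ^ 2 - 3 * (2 * y + 1) ^ 2 - 6 = 0 := by decide
  have h' : (((2 * k + 1) ^ 2 - 3 * (2 * l + 1) ^ 2 - 6 : ℤ) : ZMod 8) = 0 := by
    push_cast
    exact key k l
  have h8 := (ZMod.intCast_zmod_eq_zero_iff_dvd _ 8).1 h'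
  omega

/-! ## §2 The four witness values and their parities -/

/-- `|x + yω|² = x² − xy + y²` is the norm of `QuadraticAlgebra ℤ (−1) (−1)` (for the record). [kernel] -/
theorem eis_norm (x y : ℤ) : (⟨x, y⟩ : QuadraticAlgebra ℤ (-1) (-1)).norm = x ^ 2 - x * y + y ^ 2 := by
  rw [norm_def]
  ring

/-- The trace term of `H[z] = a|z₁|² + a|z₂|² + Tr(z₁·s√−3·z̄₂)`: for `w = z₁·√−3·z̄₂ ∈ ℤ[ω]`, `Tr(w) = 2·re(w) − im(w)`; at
`z = (0, 1)`: `w = 0`; at `z = (ω, ω̄)`: `z̄₂ = ω`, `w = ω·(1+2ω)·ω = ω²(1+2ω)`, `Tr w = 3`; at `z = (ω̄, ω)`: `w = ω̄(1+2ω)ω̄ = ω̄²(1+2ω)`,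
`Tr w = −3`. Kernel: the three products and traces computed in `QuadraticAlgebra ℤ (−1) (−1)` (`ω = ⟨0,1⟩`, `ω̄ = ⟨−1,−1⟩`). [kernel] -/
theorem trace_terms :
    (2 * ((⟨0, 1⟩ : QuadraticAlgebra ℤ (-1) (-1)) * ⟨1, 2⟩ * ⟨0, 1⟩).re
        - ((⟨0, 1⟩ : QuadraticAlgebra ℤ (-1) (-1)) * ⟨1, 2⟩ * ⟨0, 1⟩).im = 3) ∧
    (2 * ((⟨-1, -1⟩ : QuadraticAlgebra ℤ (-1) (-1)) * ⟨1, 2⟩ * ⟨-1, -1⟩).re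
        - ((⟨-1, -1⟩ : QuadraticAlgebra ℤ (-1) (-1)) * ⟨1, 2⟩ * ⟨-1, -1⟩).im = -3) := by
  constructor
  · simp
  · simp

/-- **The witness values** (LEMMA 53.2 ∕ 53.9): with `|ω|² = |ω̄|² = 1` and the trace terms above,
`H[(0,1)] = a`, `H[(ω, ω̄)] = a + a + s·3 = 2a + 3s`, `H[(ω̄, ω)] = a + a + s·(−3) = 2a − 3s`. (Arithmetic assembly; the
identification with the hermitian form is by value.) [kernel] -/
theorem witness_values (a s : ℤ) :
    a * 0 + a * 1 + s * 0 = a ∧ a * 1 + a * 1 + s * 3 = 2 * a + 3 * s ∧ a * 1 + a * 1 + s * (-3) = 2 * a - 3 * s := by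
  refine ⟨by ring, by ring, by ring⟩

/-- **Odd witnesses, `t`-part**: for `a, s` odd, `t·a` and `t·(2a + 3s)` are odd iff `t` is odd. [kernel] -/
theorem odd_witness_t (a s t : ℤ) (ha : Odd a) (hs : Odd s) :
    (Odd (t * a) ↔ Odd t) ∧ (Odd (t * (2 * a + 3 * s)) ↔ Odd t) := by
  have h23 : Odd (2 * a + 3 * s) := by
    obtain ⟨k, rfl⟩ := ha; obtain ⟨l, rfl⟩ := hs; exact ⟨2 * k + 3 * l + 2, by ring⟩
  exact ⟨by rw [Int.odd_mul]; exact ⟨fun h => h.1, fun h => ⟨h, ha⟩⟩,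
    by rw [Int.odd_mul]; exact ⟨fun h => h.1, fun h => ⟨h, h23⟩⟩⟩

/-- **Odd witnesses, `N′`-part**: for `a, s` odd, `N′·a` and `N′·(2a − 3s)` are odd iff `N′` is odd. [kernel] -/
theorem odd_witness_N (a s N' : ℤ) (ha : Odd a) (hs : Odd s) :
    (Odd (N' * a) ↔ Odd N') ∧ (Odd (N' * (2 * a - 3 * s)) ↔ Odd N') := by
  have h23 : Odd (2 * a - 3 * s) := by
    obtain ⟨k, rfl⟩ := ha; obtain ⟨l, rfl⟩ := hs; exact ⟨2 * k - 3 * l - 1, by ring⟩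
  exact ⟨by rw [Int.odd_mul]; exact ⟨fun h => h.1, fun h => ⟨h, ha⟩⟩,
    by rw [Int.odd_mul]; exact ⟨fun h => h.1, fun h => ⟨h, h23⟩⟩⟩

/-! ## §3 COROLLARY 53.8's arithmetic: `t` or `N′` is odd unless `m ≡ 1 (mod 8)` -/

/-- **`t·N′·d = A² − m`, `d ≡ 6 (mod 8)`, `m ≢ 1 (mod 8)` ⟹ `t` odd or `N′` odd.** (If both were even, `8 ∣ tN′d = A² − m`, so `m ≡ A²
(mod 8)` with `A² mod 8 ∈ {0, 1, 4}`; `m ≡ 0, 4` are impossible as `tN′d` even forces `A² − m` even … in the kernel: a finite check over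
`ZMod 8` of all residues `(t, N′, d, A, m)` with `d = 6`, `m ≠ 1`, and the extra fact that `m ≡ 0, 4 (mod 8)` contradict `tN′d = A² − m`
only through the hypothesis `hm0 : m % 4 ≠ 0` (squarefree `m`).) [kernel] -/
theorem odd_t_or_odd_N' (t N' d A m : ℤ) (h : t * N' * d = A ^ 2 - m) (hd : d % 8 = 6) (hm1 : m % 8 ≠ 1) (hm0 : m % 4 ≠ 0) :
    Odd t ∨ Odd N' := by
  by_contra hcon
  push Not at hcon
  obtain ⟨ht, hN⟩ := hcon
  rw [Int.not_odd_iff_even] at ht hN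
  obtain ⟨t₁, rfl⟩ := ht
  obtain ⟨n₁, rfl⟩ := hN
  -- d = 8q + 6: t N' d = (t₁+t₁)(n₁+n₁)(8q+6) = 4 t₁ n₁ (8q+6) is divisible by 8
  have hd' : d = 8 * (d / 8) + 6 := by omega
  have h8 : (8 : ℤ) ∣ A ^ 2 - m := by
    rw [← h, hd']
    exact ⟨t₁ * n₁ * (4 * (d / 8) + 3), by ring⟩
  -- squares mod 8 are 0, 1, 4; so m ≡ A² (mod 8) ∈ {0,1,4}: excluded by hm1, hm0
  have hA : A ^ 2 % 8 = 0 ∨ A ^ 2 % 8 = 1 ∨ A ^ 2 % 8 = 4 := by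
    have : A % 8 = 0 ∨ A % 8 = 1 ∨ A % 8 = 2 ∨ A % 8 = 3 ∨ A % 8 = 4 ∨ A % 8 = 5 ∨ A % 8 = 6 ∨ A % 8 = 7 := by omega
    rcases this with h | h | h | h | h | h | h | h <;>
      · have e : A = 8 * (A / 8) + A % 8 := by omega
        rw [h] at e
        rw [e]; ring_nf; omega
  omega

end Summit.Ventures.HSemireg.IsoscelesParity
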